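import Mathlib.Data.List.Basic

/-!
# Celestial law beyond `ℚ(i)`: three BAD residual measures, literal data and `decide +kernel` certificates (plan-lens-HodgeAV-embed g8)

HONEST FRAMING. Crux workfile for `…Theses.EightfoldBlochSeeds.BlochSeedDiscOne` (stmt-HodgeConjecture-18881; skeleton `Lines/birth.lean`
814a6a70c14e831a, `stub_rung_pad4_seedAt` UNTOUCHED, OPEN). MINT E4 «change the CM» (director-hodge g20): g6's CELESTIAL LAW / MASTER CRITERION
(`CELESTIAL-PHASE-LAW-embed-g6.md`) is frame-agnostic; g8 ran it on the d = 3 frames (K = ℚ(ω): R3 = E_ω×E_ω with diag(ω, ω̄); J₃(E) = (E², ρ),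
ρ = [[0,-1],[1,1]], any E) and on record-type frames of other imaginary quadratic K (memo `CELESTIAL-LAW-D3-embed-g8.md`). This file certifies,
by `decide +kernel` only (no `native_decide`, no `sorry`, no axiom, no instance, no notation, no Literature fact), the COMBINATORIAL content of three
explicit BAD RESIDUAL MEASURES found by the exact LPs — i.e. the statement «LAW FAILS at (frame, height)» at the level of g6's (M′)/(ω):
  * `j3genH5`  — J₃(E) frame (End E = ℤ), LINE height 5 (apex c = 15, co-letters c ≤ 15/2): 4 unit rays (U) and 4 norm-49 rays (t), μ_re = 12150/7⁵ ≠ 0;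
  * `r3H8`     — R3 frame, LINE height 8: eight of the twelve norm-7 rays on the latitude circle d/c = −3/4, μ_re = −27/160 ≠ 0;
  * `rk7H6`    — record-type frame for K = ℚ(√−7), LINE height 6: the latitude −1/3 octagon {±π, ±π̄, ±π³, ±π̄³} (N π = 2), μ = −(140/243)·i√7.
For each witness `W` (a signed measure `σ = Σ_r s_r δ_r` on null co-letter RAYS r = (C, Dd, G, B), doubled coordinates, light cone
`C² = ddCoef·Dd² + G² + dbCoef·B²`, true Weil coordinate `β̂ = (G + i√dbCoef·B)/C`, integer weights `s_r = bigM·σ_r/C_r⁴`):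
  * `raysOK W`    — every ray is null, primitive-direction-consistent with a listed LATTICE co-letter `y` (frame congruences `pred`) with `0 < C(y) ≤ cmax`
                    (= the LINE-height window), U-atoms (the first four) arbitrary sign, t-atoms (the rest) NEGATIVE (t ≥ 0 in σ = w − t);
  * `momentsOK W` — all 35 monomial moments `Σ_r s_r · Dd^i G^j B^k C^{4−i−j−k}` (i+j+k ≤ 4) vanish except the five pure-(G,B) quartics, which take the
                    values forced by `E|β̂|⁴ = 0`, `E β̂²|β̂|² = 0`, `E β̂⁴ = μ`:  (k=0,2,4 ↦ muRe/8, −muRe/(8δ), muRe/(8δ²); k=1,3 ↦ muIm/8, −muIm/(8δ)),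
                    δ = dbCoef, (muRe, muIm) = bigM·(Re μ, Im μ/√δ), and `(muRe, muIm) ≠ (0,0)`.
By g6 (M′)/(ω) + Sym⁴ separability this is exactly «a (H1)-clean corank-4 residual ray measure with Weil charge μ ≠ 0 exists», i.e. the product /
LP certificates that kill two-term rank-≤4 designs at smaller heights are ABSENT at these heights. NOT certified here (pen / memo): the frame
dictionaries (native NS lattices ↔ doubled coordinates; brute-force verified in `frames3.py`), g6's MASTER CRITERION, anything about integer designs,
Hall, positivity, semiregularity. NOTHING HERE SAYS THAT HC ∕ HC_CM ∕ HC_AV ∕ №4 ∕ 26512 ∕ 18881 ∕ H2 HOLDS OR FAILS; no rung is claimed.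
-/

set_option linter.unusedVariables false
set_option maxRecDepth 8192
set_option maxHeartbeats 4000000

namespace Summit.HodgeConjecture.HodgeConjecture.Cruxes.BlochSeedDiscOne.CelestialResidualWitnesses

/-- doubled co-letter / ray `(C, Dd, G, B)`. -/
abbrev Ray := Int × Int × Int × Int

/-- a residual-measure witness: frame data + atoms `(ray, lattice co-letter on the ray, integer weight bigM·σ/C⁴)`; the first four atoms are U. -/
structure Witness where
  ddCoef : Int
  dbCoef : Int
  cmax : Int
  pred : Nat
  bigM : Int
  muRe : Int
  muIm : Int
  atoms : List (Ray × Ray × Int)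

/-- frame congruences on a lattice co-letter: 0 = R3 / RK(m ≡ 3 mod 4) type (`C ≡ Dd`, `G ≡ B (mod 2)`), 1 = J₃(E), End E = ℤ (`C` even, `Dd = 0`,
`G ≡ B (mod 2)`, `G + C ≡ 0 (mod 3)`), 2 = same as 0 (K = ℚ(√−7), `β = (G + B√−7)/2`). -/
def latticeOK (p : Nat) (y : Ray) : Bool :=
  match y with
  | (c, dd, g, b) =>
    if p = 1 then (c % 2 == 0) && (dd == 0) && ((g - b) % 2 == 0) && ((g + c) % 3 == 0)
    else ((c - dd) % 2 == 0) && ((g - b) % 2 == 0)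

def nullRay (W : Witness) (r : Ray) : Bool :=
  match r with
  | (c, dd, g, b) => (c * c == W.ddCoef * dd * dd + g * g + W.dbCoef * b * b) && (0 < c)

/-- `y` lies on the ray `r` (all 2×2 minors vanish, both future-pointing). -/
def onRay (r y : Ray) : Bool :=
  match r, y with
  | (c, dd, g, b), (c', dd', g', b') => (0 < c) && (0 < c') && (c * dd' == c' * dd) && (c * g' == c' * g) && (c * b' == c' * b)

def zIdx {α : Type} (l : List α) : List (α × Nat) := l.zip (List.range l.length)

def raysOK (W : Witness) : Bool :=
  (W.atoms.length ≥ 5) &&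
  (zIdx W.atoms).all (fun ai =>
    match ai with
    | ((r, y, s), i) => nullRay W r && nullRay W y && onRay r y && latticeOK W.pred y && (y.1 ≤ W.cmax) && (s != 0) && (decide (i < 4) || decide (s < 0)))

def ipow (x : Int) : Nat → Int
  | 0 => 1
  | n + 1 => x * ipow x n

/-- homogenised monomial moment `Σ_r s_r · Dd^i G^j B^k C^{4-i-j-k}`. -/
def moment (W : Witness) (i j k : Nat) : Int :=
  W.atoms.foldl (fun acc a => match a with
    | ((c, dd, g, b), _, s) => acc + s * ipow dd i * ipow g j * ipow b k * ipow c (4 - i - j - k)) 0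

/-- the (M′)/(ω) target: clean except the pure-(G,B) quartics carrying μ (δ = dbCoef). Division is exact (checked in `divOK`). -/
def expected (W : Witness) (i j k : Nat) : Int :=
  if i != 0 || j + k != 4 then 0
  else if k == 0 then W.muRe / 8
  else if k == 2 then -(W.muRe / (8 * W.dbCoef))
  else if k == 4 then W.muRe / (8 * W.dbCoef * W.dbCoef)
  else if k == 1 then W.muIm / 8
  else -(W.muIm / (8 * W.dbCoef))

def divOK (W : Witness) : Bool :=
  (W.muRe % (8 * W.dbCoef * W.dbCoef) == 0) && (W.muIm % (8 * W.dbCoef) == 0) && ((W.muRe != 0) || (W.muIm != 0)) && (0 < W.bigM)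

def monos : List (Nat × Nat × Nat) :=
  (List.range 5).flatMap fun i => (List.range 5).flatMap fun j => ((List.range 5).filter fun k => i + j + k ≤ 4).map fun k => (i, j, k)

def momentsOK (W : Witness) : Bool :=
  divOK W && monos.all (fun m => match m with | (i, j, k) => moment W i j k == expected W i j k)

/-! ## the three witnesses (integer weights = bigM · σ_r / C_r⁴, σ from the exact LP; first four atoms = U (weights w), rest = −t) -/

def j3genH5 : Witness :=
  { ddCoef := 1, dbCoef := 3, cmax := 15, pred := 1, bigM := 19361664, muRe := 13996800, muIm := 0,
    atoms := [
  ((1, 0, -1, 0), (2, 0, -2, 0), 1411200),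
  ((1, 0, 1, 0), (6, 0, 6, 0), 13716864),
  ((2, 0, 1, -1), (2, 0, 1, -1), 132300),
  ((2, 0, 1, 1), (2, 0, 1, 1), 132300),
  ((14, 0, -11, -5), (14, 0, -11, -5), -27),
  ((14, 0, -11, 5), (14, 0, -11, 5), -27),
  ((14, 0, 13, -3), (14, 0, 13, -3), -225),
  ((14, 0, 13, 3), (14, 0, 13, 3), -225) ] }

def r3H8 : Witness :=
  { ddCoef := 1, dbCoef := 3, cmax := 8, pred := 0, bigM := 921600, muRe := -155520, muIm := 0,
    atoms := [
  ((4, -3, -2, -1), (8, -6, -4, -2), 1728),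
  ((4, -3, -2, 1), (8, -6, -4, 2), 576),
  ((8, -6, 1, -3), (8, -6, 1, -3), 54),
  ((8, -6, 1, 3), (8, -6, 1, 3), 27),
  ((8, -6, -5, -1), (8, -6, -5, -1), -81),
  ((8, -6, -1, -3), (8, -6, -1, -3), -90),
  ((8, -6, -1, 3), (8, -6, -1, 3), -45),
  ((8, -6, 5, -1), (8, -6, 5, -1), -9) ] }

def rk7H6 : Witness :=
  { ddCoef := 1, dbCoef := 7, cmax := 6, pred := 2, bigM := 285768, muRe := 0, muIm := -164640,
    atoms := [
  ((3, -1, -1, -1), (3, -1, -1, -1), 980),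
  ((3, -1, 1, 1), (3, -1, 1, 1), 980),
  ((6, -2, -5, 1), (6, -2, -5, 1), 49),
  ((6, -2, 5, -1), (6, -2, 5, -1), 49),
  ((3, -1, -1, 1), (3, -1, -1, 1), -980),
  ((3, -1, 1, -1), (3, -1, 1, -1), -980),
  ((6, -2, -5, -1), (6, -2, -5, -1), -49),
  ((6, -2, 5, 1), (6, -2, 5, 1), -49) ] }

/-! ## certificates -/

theorem monos_length : monos.length = 35 := by decide +kernel
theorem j3genH5_rays : raysOK j3genH5 = true := by decide +kernel
theorem j3genH5_moments : momentsOK j3genH5 = true := by decide +kernel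
theorem r3H8_rays : raysOK r3H8 = true := by decide +kernel
theorem r3H8_moments : momentsOK r3H8 = true := by decide +kernel
theorem rk7H6_rays : raysOK rk7H6 = true := by decide +kernel
theorem rk7H6_moments : momentsOK rk7H6 = true := by decide +kernel

/-- Prop reading: every monomial moment of each witness takes its (M′)/(ω) value, and the Weil charge is non-zero. -/
theorem moments_eq_expected :
    (∀ m ∈ monos, moment j3genH5 m.1 m.2.1 m.2.2 = expected j3genH5 m.1 m.2.1 m.2.2) ∧
    (∀ m ∈ monos, moment r3H8 m.1 m.2.1 m.2.2 = expected r3H8 m.1 m.2.1 m.2.2) ∧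
    (∀ m ∈ monos, moment rk7H6 m.1 m.2.1 m.2.2 = expected rk7H6 m.1 m.2.1 m.2.2) := by
  refine ⟨?_, ?_, ?_⟩
  · have h := j3genH5_moments
    unfold momentsOK at h
    simp only [Bool.and_eq_true, List.all_eq_true] at h
    intro m hm
    have := h.2 m hm
    rcases m with ⟨i, j, k⟩
    simpa using this
  · have h := r3H8_moments
    unfold momentsOK at h
    simp only [Bool.and_eq_true, List.all_eq_true] at h
    intro m hm
    have := h.2 m hm
    rcases m with ⟨i, j, k⟩
    simpa using this
  · have h := rk7H6_moments
    unfold momentsOK at h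
    simp only [Bool.and_eq_true, List.all_eq_true] at h
    intro m hm
    have := h.2 m hm
    rcases m with ⟨i, j, k⟩
    simpa using this

theorem weil_charges_nonzero : j3genH5.muRe ≠ 0 ∧ r3H8.muRe ≠ 0 ∧ rk7H6.muIm ≠ 0 := by decide +kernel

end Summit.HodgeConjecture.HodgeConjecture.Cruxes.BlochSeedDiscOne.CelestialResidualWitnesses
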